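import Mathlib
import Summits.Ventures.PercRepro2.SwOutMixedArmsBaseReal

/-!
# The several-arms base: the red hull formula (blind cell PercRepro2, night-4 g20, 2026-08-27;
proofs/NIGHT4-G20.md §4′)

At a point `q` of the raw cube without RED-SIDE LEAK (`LeakRR`: some u-arm red and some arm
attached red with a red outside edge or a blue piece), the red cluster of `h` in the realisation
`mixedRealR σ q` is the predicted set `redSetR q` = `h`, the red u-arms, `u` (when some u-arm is
red), the dropped vertices attached red (when some u-arm is red), the red pieces and the red far
arms — by a closure argument (`redSetR_closed`: no red edge leaves the set) and the connectivity
of every arm inside itself (`cluster_mixedRealR`).  The single-arm twin is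
`BigBlock.MixedBase.cluster_mixedReal` (`SwOutMixedBaseHull`).
-/

namespace Summit.Ventures.PercRepro2

namespace MixedArms

open Hull LocRows

variable {V : Type*} {E : Type*}

open scoped Classical

section RedSet

variable (h u : V) {ι ρ ν κ : Type*} (U : ι → Set V) (p : ρ → V) (Ah : ν → Set V) (F : κ → Set V)

/-- The red cluster of `h` predicted at a point `q`. -/
def redSetR (q : PtR ι ρ ν κ) : Set V :=
  {h} ∪ {x | ∃ j, q.1 j = true ∧ x ∈ U j} ∪ {x | x = u ∧ ∃ j, q.1 j = true} ∪
    {x | ∃ r, x = p r ∧ (∃ j, q.1 j = true) ∧ q.2.2.1 r = true} ∪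
    {x | ∃ i, q.2.1 i = true ∧ x ∈ Ah i} ∪ {x | ∃ k, q.2.2.2.2 k = true ∧ x ∈ F k}

variable (arm : ν → ρ)

/-- The red-side leaks: some u-arm red and some arm attached red with its outside edges red or one
of its pieces blue. -/
def LeakRR (q : PtR ι ρ ν κ) : Prop :=
  (∃ j, q.1 j = true) ∧ ∃ r, q.2.2.1 r = true ∧
    (q.2.2.2.1 r = false ∨ ∃ i, arm i = r ∧ q.2.1 i = false)

end RedSet

section Hull

variable {ends : E → Sym2 V} {σ : Config E} {h u : V} {ι ρ ν κ : Type*} {U : ι → Set V}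
  {p : ρ → V} {Ah : ν → Set V} {arm : ν → ρ} {F : κ → Set V}
  (hb : MixedBaseR ends σ h u U p Ah arm F)
include hb

omit hb in
/-- Membership in `redSetR`. -/
lemma mem_redSetR_iff {q : PtR ι ρ ν κ} {x : V} :
    x ∈ redSetR h u U p Ah F q ↔ x = h ∨ (∃ j, q.1 j = true ∧ x ∈ U j) ∨
      (x = u ∧ ∃ j, q.1 j = true) ∨ (∃ r, x = p r ∧ (∃ j, q.1 j = true) ∧ q.2.2.1 r = true) ∨
      (∃ i, q.2.1 i = true ∧ x ∈ Ah i) ∨ ∃ k, q.2.2.2.2 k = true ∧ x ∈ F k := by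
  simp only [redSetR, Set.mem_union, Set.mem_singleton_iff, Set.mem_setOf_eq, or_assoc]

/-- The colour of an edge touching a red u-arm is the base colour. -/
lemma MixedBaseR.mixedRealR_U_red {q : PtR ι ρ ν κ} {j : ι} (hj : q.1 j = true) {e : E}
    (he : e ∈ touches ends (U j)) : mixedRealR ends u U p Ah F σ q e = σ e := by
  rw [hb.mixedRealR_apply_U he, if_pos hj]

/-- **Closure**: at a point without red-side leak, `redSetR` is closed under red adjacency. -/
theorem MixedBaseR.redSetR_closed {q : PtR ι ρ ν κ} (hq : ¬ LeakRR arm q) :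
    ∀ x ∈ redSetR h u U p Ah F q, ∀ y,
      (openGraph ends (mixedRealR ends u U p Ah F σ q)).Adj x y → y ∈ redSetR h u U p Ah F q := by
  intro x hx y hxy
  obtain ⟨_, e, he, hends⟩ := openGraph_adj.1 hxy
  rw [mem_redSetR_iff] at hx ⊢
  rcases hx with hxh | ⟨j, hj, hx⟩ | ⟨hxu, j, hj⟩ | ⟨r, hxp, ⟨j, hj⟩, huP⟩ | ⟨i, hi, hx⟩ |
    ⟨k, hk, hx⟩
  · -- x = h: the edge enters an arm, red iff the arm's coordinate is `true`
    rw [hxh] at hends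
    rcases hb.h_edges e y hends with ⟨j, hy⟩ | ⟨i, hy⟩ | ⟨k, hy⟩
    · have ht : e ∈ touches ends (U j) := ⟨y, hy, h, ends_swap hends⟩
      rw [hb.mixedRealR_apply_U ht] at he
      by_cases hj : q.1 j = true
      · exact Or.inr (Or.inl ⟨j, hj, hy⟩)
      · rw [if_neg hj, hb.h_red e y hends] at he
        exact absurd he (by decide)
    · have ht : e ∈ touches ends (Ah i) := ⟨y, hy, h, ends_swap hends⟩
      rw [hb.mixedRealR_apply_Ah ht] at he
      by_cases hi : q.2.1 i = true
      · exact Or.inr (Or.inr (Or.inr (Or.inr (Or.inl ⟨i, hi, hy⟩))))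
      · rw [if_neg hi, hb.h_red e y hends] at he
        exact absurd he (by decide)
    · have ht : e ∈ touches ends (F k) := ⟨y, hy, h, ends_swap hends⟩
      rw [hb.mixedRealR_apply_F ht] at he
      by_cases hk : q.2.2.2.2 k = true
      · exact Or.inr (Or.inr (Or.inr (Or.inr (Or.inr ⟨k, hk, hy⟩))))
      · rw [if_neg hk, hb.h_red e y hends] at he
        exact absurd he (by decide)
  · -- x in a red u-arm: inside, to h, to u, or outside (blue)
    have ht : e ∈ touches ends (U j) := ⟨x, hx, y, hends⟩
    rw [hb.mixedRealR_U_red hj ht] at he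
    obtain ⟨x', y', hxy', hx', hy'⟩ := hb.ends_of_touches_U ht
    rw [hends, Sym2.eq_iff] at hxy'
    rcases hxy' with ⟨h1, h2⟩ | ⟨h1, h2⟩
    · rw [← h2] at hy'
      rcases hy' with hy | hyh | hyu | ⟨hyh, hyu, hyp, hout⟩
      · exact Or.inr (Or.inl ⟨j, hj, hy⟩)
      · exact Or.inl hyh
      · exact Or.inr (Or.inr (Or.inl ⟨hyu, j, hj⟩))
      · rw [hb.bdry_blue e x y hends (Or.inl (Or.inl (Set.mem_iUnion.2 ⟨j, hx⟩))) hyh hyu hyp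
          hout] at he
        exact absurd he (by decide)
    · rw [← h2] at hx'
      exact Or.inr (Or.inl ⟨j, hj, hx'⟩)
  · -- x = u (some red u-arm): the edge goes into a u-arm or to a dropped vertex
    rw [hxu] at hends
    rcases hb.u_edges e y hends with ⟨j', hy⟩ | ⟨r, hyp⟩
    · have ht : e ∈ touches ends (U j') := ⟨y, hy, u, ends_swap hends⟩
      rw [hb.mixedRealR_apply_U ht] at he
      by_cases hj' : q.1 j' = true
      · exact Or.inr (Or.inl ⟨j', hj', hy⟩)
      · rw [if_neg hj', hb.u_red e y hends] at he
        exact absurd he (by decide)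
    · rw [hyp] at hends
      have ht : e ∈ clsUPR ends u p r := hends
      rw [hb.mixedRealR_apply_UP ht] at he
      by_cases huP : q.2.2.1 r = true
      · exact Or.inr (Or.inr (Or.inr (Or.inl ⟨r, hyp, ⟨j, hj⟩, huP⟩)))
      · rw [if_neg huP, hb.u_red e (p r) hends] at he
        exact absurd he (by decide)
  · -- x = p r attached red: its edges go to u, into a piece of r (a dead edge), or outside
    rw [hxp] at hends
    rcases hb.p_edges r e y hends with hyu | ⟨i, hir, hy⟩ | ⟨hyh, hyp, hyarms⟩
    · exact Or.inr (Or.inr (Or.inl ⟨hyu, j, hj⟩))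
    · -- a dead edge: red only when the piece is blue — excluded by the leak condition
      have ht : e ∈ touches ends (Ah i) := ⟨y, hy, p r, ends_swap hends⟩
      rw [hb.mixedRealR_apply_Ah ht] at he
      by_cases hi : q.2.1 i = true
      · rw [if_pos hi, hb.dead_blue r e y hends ⟨i, hy⟩] at he
        exact absurd he (by decide)
      · exact absurd ⟨⟨j, hj⟩, r, huP, Or.inr ⟨i, hir, by simpa using hi⟩⟩ hq
    · -- an outside edge: red only when `e_r = false` — excluded by the leak condition
      by_cases hyu : y = u
      · exact Or.inr (Or.inr (Or.inl ⟨hyu, j, hj⟩))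
      · have hyA : ∀ i, y ∉ Ah i := fun i hyA =>
          hyarms (Or.inl (Or.inr (Set.mem_iUnion.2 ⟨i, hyA⟩)))
        have ht : e ∈ clsExtR ends u p Ah r := ⟨y, hends, hyu, hyA⟩
        rw [hb.mixedRealR_apply_Ext ht] at he
        by_cases hc : q.2.2.2.1 r = true
        · rw [if_pos hc, hb.ext_blue r e y hends hyu hyA] at he
          exact absurd he (by decide)
        · exact absurd ⟨⟨j, hj⟩, r, huP, Or.inl (by simpa using hc)⟩ hq
  · -- x in a red piece: inside, to h, a dead edge (blue), or outside (blue)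
    have ht : e ∈ touches ends (Ah i) := ⟨x, hx, y, hends⟩
    rw [hb.mixedRealR_apply_Ah ht, if_pos hi] at he
    obtain ⟨x', y', hxy', hx', hy'⟩ := hb.ends_of_touches_Ah ht
    rw [hends, Sym2.eq_iff] at hxy'
    rcases hxy' with ⟨h1, h2⟩ | ⟨h1, h2⟩
    · rw [← h2] at hy'
      rcases hy' with hy | hyh | hyp | ⟨hyh, hyu, hyp, hout⟩
      · exact Or.inr (Or.inr (Or.inr (Or.inr (Or.inl ⟨i, hi, hy⟩))))
      · exact Or.inl hyh
      · rw [hyp] at hends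
        rw [hb.dead_blue (arm i) e x (ends_swap hends) ⟨i, hx⟩] at he
        exact absurd he (by decide)
      · rw [hb.bdry_blue e x y hends (Or.inl (Or.inr (Set.mem_iUnion.2 ⟨i, hx⟩))) hyh hyu hyp
          hout] at he
        exact absurd he (by decide)
    · rw [← h2] at hx'
      exact Or.inr (Or.inr (Or.inr (Or.inr (Or.inl ⟨i, hi, hx'⟩))))
  · -- x in a red far arm: inside, to h, or outside (blue)
    have ht : e ∈ touches ends (F k) := ⟨x, hx, y, hends⟩
    rw [hb.mixedRealR_apply_F ht, if_pos hk] at he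
    obtain ⟨x', y', hxy', hx', hy'⟩ := hb.ends_of_touches_F ht
    rw [hends, Sym2.eq_iff] at hxy'
    rcases hxy' with ⟨h1, h2⟩ | ⟨h1, h2⟩
    · rw [← h2] at hy'
      rcases hy' with hy | hyh | ⟨hyh, hyu, hyp, hout⟩
      · exact Or.inr (Or.inr (Or.inr (Or.inr (Or.inr ⟨k, hk, hy⟩))))
      · exact Or.inl hyh
      · rw [hb.bdry_blue e x y hends (Or.inr (Set.mem_iUnion.2 ⟨k, hx⟩)) hyh hyu hyp hout] at he
        exact absurd he (by decide)
    · rw [← h2] at hx'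
      exact Or.inr (Or.inr (Or.inr (Or.inr (Or.inr ⟨k, hk, hx'⟩))))

/-- An edge inside `U j ∪ {h}` touches `U j`. -/
lemma MixedBaseR.touches_U_of_within {j : ι} {e : E} (he : e ∈ within ends (U j ∪ {h})) :
    e ∈ touches ends (U j) := by
  obtain ⟨x, hx, y, hy, hxy⟩ := he
  rcases hx with hx | hx
  · exact ⟨x, hx, y, hxy⟩
  · rcases hy with hy | hy
    · exact ⟨y, hy, x, ends_swap hxy⟩
    · exfalso
      rw [Set.mem_singleton_iff] at hx hy
      subst hx
      subst hy
      exact hb.loop_h e hxy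

/-- An edge inside `Ah i ∪ {h}` touches `Ah i`. -/
lemma MixedBaseR.touches_Ah_of_within {i : ν} {e : E} (he : e ∈ within ends (Ah i ∪ {h})) :
    e ∈ touches ends (Ah i) := by
  obtain ⟨x, hx, y, hy, hxy⟩ := he
  rcases hx with hx | hx
  · exact ⟨x, hx, y, hxy⟩
  · rcases hy with hy | hy
    · exact ⟨y, hy, x, ends_swap hxy⟩
    · exfalso
      rw [Set.mem_singleton_iff] at hx hy
      subst hx
      subst hy
      exact hb.loop_h e hxy

/-- An edge inside `F k ∪ {h}` touches `F k`. -/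
lemma MixedBaseR.touches_F_of_within {k : κ} {e : E} (he : e ∈ within ends (F k ∪ {h})) :
    e ∈ touches ends (F k) := by
  obtain ⟨x, hx, y, hy, hxy⟩ := he
  rcases hx with hx | hx
  · exact ⟨x, hx, y, hxy⟩
  · rcases hy with hy | hy
    · exact ⟨y, hy, x, ends_swap hxy⟩
    · exfalso
      rw [Set.mem_singleton_iff] at hx hy
      subst hx
      subst hy
      exact hb.loop_h e hxy

/-- The red edges of the base inside a red u-arm (with `h`) are red in the realisation. -/
lemma MixedBaseR.insideConfig_U_le {q : PtR ι ρ ν κ} {j : ι} (hj : q.1 j = true) :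
    insideConfig ends (U j ∪ {h}) σ ≤ mixedRealR ends u U p Ah F σ q := by
  intro e
  by_cases he : insideConfig ends (U j ∪ {h}) σ e = true
  · rw [he]
    obtain ⟨hσe, hw⟩ := insideConfig_eq_true_iff.1 he
    rw [hb.mixedRealR_U_red hj (hb.touches_U_of_within hw), hσe]
  · simp only [Bool.not_eq_true] at he
    rw [he]
    exact Bool.false_le _

/-- The red edges of the base inside a red piece (with `h`) are red in the realisation. -/
lemma MixedBaseR.insideConfig_Ah_le {q : PtR ι ρ ν κ} {i : ν} (hi : q.2.1 i = true) :
    insideConfig ends (Ah i ∪ {h}) σ ≤ mixedRealR ends u U p Ah F σ q := by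
  intro e
  by_cases he : insideConfig ends (Ah i ∪ {h}) σ e = true
  · rw [he]
    obtain ⟨hσe, hw⟩ := insideConfig_eq_true_iff.1 he
    rw [hb.mixedRealR_apply_Ah (hb.touches_Ah_of_within hw), if_pos hi, hσe]
  · simp only [Bool.not_eq_true] at he
    rw [he]
    exact Bool.false_le _

/-- The red edges of the base inside a red far arm (with `h`) are red in the realisation. -/
lemma MixedBaseR.insideConfig_F_le {q : PtR ι ρ ν κ} {k : κ} (hk : q.2.2.2.2 k = true) :
    insideConfig ends (F k ∪ {h}) σ ≤ mixedRealR ends u U p Ah F σ q := by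
  intro e
  by_cases he : insideConfig ends (F k ∪ {h}) σ e = true
  · rw [he]
    obtain ⟨hσe, hw⟩ := insideConfig_eq_true_iff.1 he
    rw [hb.mixedRealR_apply_F (hb.touches_F_of_within hw), if_pos hk, hσe]
  · simp only [Bool.not_eq_true] at he
    rw [he]
    exact Bool.false_le _

/-- **The red hull formula**: at a point without red-side leak, the red cluster of `h` is
`redSetR` (assuming an edge between `u` and every dropped vertex). -/
theorem MixedBaseR.cluster_mixedRealR (hup : ∀ r, ∃ e, ends e = s(u, p r)) {q : PtR ι ρ ν κ}
    (hq : ¬ LeakRR arm q) :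
    cluster ends (mixedRealR ends u U p Ah F σ q) h = redSetR h u U p Ah F q := by
  apply Set.Subset.antisymm
  · intro v hv
    exact mem_of_conn_of_closed (hb.redSetR_closed hq)
      (by rw [mem_redSetR_iff]; exact Or.inl rfl) hv
  · intro v hv
    rw [mem_redSetR_iff] at hv
    have hu : (∃ j, q.1 j = true) → u ∈ cluster ends (mixedRealR ends u U p Ah F σ q) h := by
      rintro ⟨j, hj⟩
      obtain ⟨e, x, hex, hx⟩ := hb.u_adj_U j
      have hxc : x ∈ cluster ends (mixedRealR ends u U p Ah F σ q) h :=
        cluster_mono (hb.insideConfig_U_le hj) h (hb.U_conn j x hx)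
      have hred : mixedRealR ends u U p Ah F σ q e = true := by
        rw [hb.mixedRealR_U_red hj ⟨x, hx, u, ends_swap hex⟩]
        exact hb.u_red e x hex
      exact mem_cluster_of_edge hxc hred (ends_swap hex)
    rcases hv with hvh | ⟨j, hj, hv⟩ | ⟨hvu, hs⟩ | ⟨r, hvp, hs, huP⟩ | ⟨i, hi, hv⟩ | ⟨k, hk, hv⟩
    · rw [hvh]
      exact mem_cluster_self _ _ _
    · exact cluster_mono (hb.insideConfig_U_le hj) h (hb.U_conn j v hv)
    · rw [hvu]
      exact hu hs
    · rw [hvp]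
      obtain ⟨e, hupr⟩ := hup r
      have hred : mixedRealR ends u U p Ah F σ q e = true := by
        rw [hb.mixedRealR_apply_UP hupr, if_pos huP]
        exact hb.u_red e (p r) hupr
      exact mem_cluster_of_edge (hu hs) hred hupr
    · exact cluster_mono (hb.insideConfig_Ah_le hi) h (hb.Ah_conn i v hv)
    · exact cluster_mono (hb.insideConfig_F_le hk) h (hb.F_conn k v hv)

end Hull

end MixedArms

end Summit.Ventures.PercRepro2
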